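import Summits.QuantumFields.BalabanUV.T4Continuum.Support.NE7StencilForms
import Summits.QuantumFields.BalabanUV.T4Continuum.Support.NE7LyapunovStencil1D
import HarnessLib

/-!
# NE7LyapunovTensor — THE ONE-DIRECTION LYAPUNOV INEQUALITIES AS STENCIL FORMS AND THEIR FOUR-FOLD TENSOR PRODUCT:
# `(A_{e₀}⊗A_{e₁}⊗A_{e₂}⊗A_{e₃})(v) ≤ (Π_μ g_μ)·(B_{e₀}⊗B_{e₁}⊗B_{e₂}⊗B_{e₃})(v)`, `g = 3` for the flat (longitudinal) direction, `17∕8` for the tent (transverse) ones — `3·(17∕8)³ < 2⁴·2 = L^{d−2}·L³∕… `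
# i.e. per level the Lyapunov form of the lift's main part grows by `≤ (3∕2)(17∕16)³·L^{d−2} = 1.80·L² < L³` at `d = 4`, `L = 2`
# (lineage `b2b-balaban-t4-ne7b-p1`, gen 162; route (H′), memo `t4/b2b-balaban-t4-ne7b-p1/g162/records/SCOPING-LEVELMASSES.md` §11, file (R3c-inst))

Cell `pub-balaban`, rung (B)+1 sub-cell t4, lineage `b2b-balaban-t4-ne7b-p1` (row NE7b OWNER + CRUX PROVER; junction service for row NE7 on ROAD-G116 §6 (G3)), generation 162.
WHY.  ✓ `NE7LyapunovStencil1D` gives the flat and tent one-direction inequalities on every finite abelian group; ✓ `NE7StencilForms.formProd_le` multiplies such inequalities across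
commuting directions.  THIS FILE writes the two inequalities as `formEval` inequalities between explicit stencil forms (`Aflat e ≤ 3·Bform e`, `Atent e ≤ (17∕8)·Bform e`) and takes the
four-fold product over the steps `e₀,…,e₃` of a torus `(ℤ∕N)⁴` (any finite abelian group, any four steps), with the flat factor in the longitudinal direction `κ`.
WHAT ([folklore]; DATA defs of the stencils and forms (all coefficients explicit rationals, padded to `Fin 4` stencils and `Fin 5` forms), 0 sorry):
§1 the stencils `delta4`, `grad4`, `bst4`, `gradb4`, `lapb4`, `mid4`, `hgrad4`, `lapI4` and their actions (`act_…`); §2 the forms `Aflat`, `Atent`, `Bform`, their coefficients are nonnegative, and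
**`formEval_Aflat_le`** (`≤ 3·Bform`), **`formEval_Atent_le`** (`≤ (17∕8)·Bform`) from ✓ `flat_lyapunov` ∕ ✓ `tent_lyapunov`; §3 **`formProd4_le`** (generic four-fold product of form inequalities)
and **`lyapunov_tensor4_le`**: for steps `e : Fin 4 → Γ` and a longitudinal direction `κ`, with `A μ := if μ = κ then Aflat (e μ) else Atent (e μ)`,
`(A 0 ⊗ A 1 ⊗ A 2 ⊗ A 3)(v) ≤ 3·(17∕8)³·(Bform (e 0) ⊗ ⋯ ⊗ Bform (e 3))(v)`.
WHAT IS NOT HERE: the identification of the left∕right products with the fine∕coarse `d`-dimensional Lyapunov forms of the lift (block computations, file (R3b)), the level iteration, the gauge part.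
HONEST FRAMING (page 1): elementary algebra of OUR bookkeeping objects; nothing of Bałaban's asserted; NOT (C), NOT (G3), NOT (G), NOT NE7∕NE3 as spine nodes; row NE7b NOT PRINTED ∕ NOT PROVED; spine 0∕9;
finite T⁴ rung (B)+1 — NOT infinite volume, NOT mass gap, NOT BetaPertH, NOT Clay.
-/

set_option autoImplicit false

open scoped BigOperators RealInnerProductSpace
open Finset

namespace Summit.QuantumFields.BalabanUV.T4Continuum.NE7LyapunovTensor

open NE7StencilForms (act conv formEval formProd formEval_nonneg formProd_le)
open NE7LyapunovStencil1D (flat_lyapunov tent_lyapunov)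

noncomputable section

variable {Γ : Type*} [AddCommGroup Γ]
variable {X : Type*} [NormedAddCommGroup X] [InnerProductSpace ℝ X]

/-! ## §1 The stencils (padded to four entries) -/

/-- `δ`: the identity stencil. [folklore] -/
def delta4 (e : Γ) : Fin 4 → ℝ × Γ := ![((1 : ℝ), (0 : Γ)), (0, e), (0, e), (0, e)]
/-- `∇_e`: the forward difference. [folklore] -/
def grad4 (e : Γ) : Fin 4 → ℝ × Γ := ![((-1 : ℝ), (0 : Γ)), (1, e), (0, e), (0, e)]
/-- `b_e = (3∕4)·1 + (1∕4)·τ_e`: the one-direction stencil of the Whitney lift. [folklore] -/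
def bst4 (e : Γ) : Fin 4 → ℝ × Γ := ![((3 / 4 : ℝ), (0 : Γ)), (1 / 4, e), (0, e), (0, e)]
/-- `∇_e b_e`. [folklore] -/
def gradb4 (e : Γ) : Fin 4 → ℝ × Γ := ![((-(3 / 4) : ℝ), (0 : Γ)), (1 / 2, e), (1 / 4, e + e), (0, e)]
/-- `Δ_e b_e` (forward form `w_{y+2e} − 2w_{y+e} + w_y`). [folklore] -/
def lapb4 (e : Γ) : Fin 4 → ℝ × Γ := ![((3 / 4 : ℝ), (0 : Γ)), (-(5 / 4), e), (1 / 4, e + e), (1 / 4, e + e + e)]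
/-- the tent midpoint `m = (1∕2)(1 + τ_e)`. [folklore] -/
def mid4 (e : Γ) : Fin 4 → ℝ × Γ := ![((1 / 2 : ℝ), (0 : Γ)), (1 / 2, e), (0, e), (0, e)]
/-- the half difference `(1∕2)∇_e` (= `m − 1 = τ_e − m`). [folklore] -/
def hgrad4 (e : Γ) : Fin 4 → ℝ × Γ := ![((-(1 / 2) : ℝ), (0 : Γ)), (1 / 2, e), (0, e), (0, e)]
/-- the tent second difference `m − 2τ_e + τ_e m`. [folklore] -/
def lapI4 (e : Γ) : Fin 4 → ℝ × Γ := ![((1 / 2 : ℝ), (0 : Γ)), (-1, e), (1 / 2, e + e), (0, e)]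

section Actions

variable (e : Γ) (v : Γ → X) (y : Γ)

/-- The identity stencil acts as the identity. [folklore] -/
theorem act_delta4 : act (delta4 e) v y = v y := by
  simp [act, delta4, Fin.sum_univ_four]
/-- The forward-difference stencil. [folklore] -/
theorem act_grad4 : act (grad4 e) v y = v (y + e) - v y := by
  simp [act, grad4, Fin.sum_univ_four]; abel
/-- The Whitney one-direction stencil `b_e`. [folklore] -/
theorem act_bst4 : act (bst4 e) v y = (3 / 4 : ℝ) • v y + (1 / 4 : ℝ) • v (y + e) := by
  simp [act, bst4, Fin.sum_univ_four]
/-- `∇_e b_e` is the forward difference of `b_e`. [folklore] -/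
theorem act_gradb4 : act (gradb4 e) v y = act (bst4 e) v (y + e) - act (bst4 e) v y := by
  simp [act, gradb4, bst4, Fin.sum_univ_four, add_assoc]; module
/-- `Δ_e b_e` is the forward second difference of `b_e`. [folklore] -/
theorem act_lapb4 : act (lapb4 e) v y = act (bst4 e) v (y + e + e) - (2 : ℝ) • act (bst4 e) v (y + e) + act (bst4 e) v y := by
  simp [act, lapb4, bst4, Fin.sum_univ_four, add_assoc]; module
/-- The tent midpoint stencil. [folklore] -/
theorem act_mid4 : act (mid4 e) v y = (1 / 2 : ℝ) • v y + (1 / 2 : ℝ) • v (y + e) := by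
  simp [act, mid4, Fin.sum_univ_four]
/-- The half difference is `m − 1`. [folklore] -/
theorem act_hgrad4_eq_mid_sub : act (hgrad4 e) v y = act (mid4 e) v y - v y := by
  simp [act, hgrad4, mid4, Fin.sum_univ_four]; module
/-- The half difference is `τ_e − m`. [folklore] -/
theorem act_hgrad4_eq_sub_mid : act (hgrad4 e) v y = v (y + e) - act (mid4 e) v y := by
  simp [act, hgrad4, mid4, Fin.sum_univ_four]; module
/-- The tent second difference is `m − 2τ_e + τ_e m`. [folklore] -/
theorem act_lapI4 : act (lapI4 e) v y = act (mid4 e) v y - (2 : ℝ) • v (y + e) + act (mid4 e) v (y + e) := by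
  simp [act, lapI4, mid4, Fin.sum_univ_four, add_assoc]; module

end Actions

/-! ## §2 The forms and the one-direction inequalities as `formEval` inequalities -/

/-- **`A^{flat}_e`** = `2·‖·‖² + (3∕2)·‖∇_e·‖²` (the coarse form of `M` of the flat refinement), padded to five entries. [folklore] -/
def Aflat (e : Γ) : Fin 5 → ℝ × (Fin 4 → ℝ × Γ) := ![(2, delta4 e), (3 / 2, grad4 e), (0, delta4 e), (0, delta4 e), (0, delta4 e)]
/-- **`A^{tent}_e`** = `‖·‖² + ‖m·‖² + (1∕4)(‖(m−1)·‖² + ‖(τ−m)·‖²) + (5∕8)‖(m − 2τ + τm)·‖²` (the coarse form of `M` of the tent refinement). [folklore] -/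
def Atent (e : Γ) : Fin 5 → ℝ × (Fin 4 → ℝ × Γ) := ![(1, delta4 e), (1, mid4 e), (1 / 4, hgrad4 e), (1 / 4, hgrad4 e), (5 / 8, lapI4 e)]
/-- **`B_e`** = `‖b·‖² + (1∕4)‖∇b·‖² + (5∕8)‖Δb·‖²` = the Lyapunov form `M = 1 + (1∕4)∇*∇ + (5∕8)Δ*Δ` after the stencil `b_e`. [folklore] -/
def Bform (e : Γ) : Fin 3 → ℝ × (Fin 4 → ℝ × Γ) := ![(1, bst4 e), (1 / 4, gradb4 e), (5 / 8, lapb4 e)]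

/-- The coefficients of `Aflat` are nonnegative. [folklore] -/
theorem Aflat_nonneg (e : Γ) : ∀ i, 0 ≤ (Aflat e i).1 := by
  intro i; fin_cases i <;> norm_num [Aflat]
/-- The coefficients of `Atent` are nonnegative. [folklore] -/
theorem Atent_nonneg (e : Γ) : ∀ i, 0 ≤ (Atent e i).1 := by
  intro i; fin_cases i <;> norm_num [Atent]
/-- The coefficients of `Bform` are nonnegative. [folklore] -/
theorem Bform_nonneg (e : Γ) : ∀ i, 0 ≤ (Bform e i).1 := by
  intro i; fin_cases i <;> norm_num [Bform]

variable [Fintype Γ]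

/-- `formEval (Bform e) v` written out. [folklore] -/
theorem formEval_Bform (e : Γ) (v : Γ → X) :
    formEval (Bform e) v = ∑ y, (‖act (bst4 e) v y‖ ^ 2 + (1 / 4 : ℝ) * ‖act (bst4 e) v (y + e) - act (bst4 e) v y‖ ^ 2
      + (5 / 8 : ℝ) * ‖act (bst4 e) v (y + e + e) - (2 : ℝ) • act (bst4 e) v (y + e) + act (bst4 e) v y‖ ^ 2) := by
  simp only [formEval, Bform, Fin.sum_univ_three, Matrix.cons_val_zero, Matrix.cons_val_one, Matrix.cons_val_two, Matrix.head_cons, Matrix.tail_cons,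
    act_gradb4, act_lapb4, Finset.sum_add_distrib, Finset.mul_sum, one_mul]

/-- **`A^{flat}_e ≤ 3·B_e`** (✓ `flat_lyapunov`). [folklore] -/
theorem formEval_Aflat_le (e : Γ) (v : Γ → X) : formEval (Aflat e) v ≤ 3 * formEval (Bform e) v := by
  have h := flat_lyapunov v (act (bst4 e) v) e (fun y => act_bst4 e v y)
  have hA : formEval (Aflat e) v = ∑ y, (2 * ‖v y‖ ^ 2 + (3 / 2 : ℝ) * ‖v (y + e) - v y‖ ^ 2) := by
    simp only [formEval, Aflat, Fin.sum_univ_five, Matrix.cons_val_zero, Matrix.cons_val_one, Matrix.cons_val_two, Matrix.cons_val_three, Matrix.cons_val_four,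
      Matrix.head_cons, Matrix.tail_cons, act_delta4, act_grad4, zero_mul, add_zero, Finset.sum_add_distrib, Finset.mul_sum, Finset.sum_const_zero]
  rw [hA, formEval_Bform]
  exact h

/-- **`A^{tent}_e ≤ (17∕8)·B_e`** (✓ `tent_lyapunov`). [folklore] -/
theorem formEval_Atent_le (e : Γ) (v : Γ → X) : formEval (Atent e) v ≤ (17 / 8 : ℝ) * formEval (Bform e) v := by
  have h := tent_lyapunov v (act (bst4 e) v) (act (mid4 e) v) e (fun y => act_bst4 e v y) (fun y => act_mid4 e v y)
  have hA : formEval (Atent e) v = ∑ y, (‖v y‖ ^ 2 + ‖act (mid4 e) v y‖ ^ 2 + (1 / 4 : ℝ) * (‖act (mid4 e) v y - v y‖ ^ 2 + ‖v (y + e) - act (mid4 e) v y‖ ^ 2)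
      + (5 / 8 : ℝ) * ‖act (mid4 e) v y - (2 : ℝ) • v (y + e) + act (mid4 e) v (y + e)‖ ^ 2) := by
    simp only [formEval, Atent, Fin.sum_univ_five, Matrix.cons_val_zero, Matrix.cons_val_one, Matrix.cons_val_two, Matrix.cons_val_three, Matrix.cons_val_four,
      Matrix.head_cons, Matrix.tail_cons, act_delta4, act_lapI4, one_mul, Finset.sum_add_distrib, Finset.mul_sum, mul_add]
    simp only [act_hgrad4_eq_mid_sub]
    have h2 : ∑ y, (1 / 4 : ℝ) * ‖act (mid4 e) v y - v y‖ ^ 2 = ∑ y, (1 / 4 : ℝ) * ‖v (y + e) - act (mid4 e) v y‖ ^ 2 := by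
      refine Finset.sum_congr rfl fun y _ => ?_
      rw [← act_hgrad4_eq_mid_sub, act_hgrad4_eq_sub_mid]
    rw [← h2]
    ring
  rw [hA, formEval_Bform]
  exact h

/-! ## §3 The four-fold tensor product -/

section Tensor

variable {ι₀ ι₁ ι₂ ι₃ κ₀ κ₁ κ₂ κ₃ : Type*} [Fintype ι₀] [Fintype ι₁] [Fintype ι₂] [Fintype ι₃] [Fintype κ₀] [Fintype κ₁] [Fintype κ₂] [Fintype κ₃]
variable {j₀ j₁ j₂ j₃ l₀ l₁ l₂ l₃ : Type*} [Fintype j₀] [Fintype j₁] [Fintype j₂] [Fintype j₃] [Fintype l₀] [Fintype l₁] [Fintype l₂] [Fintype l₃]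

/-- **FOUR-FOLD PRODUCT OF FORM INEQUALITIES** (all coefficients nonnegative, constants nonnegative). [folklore] -/
theorem formProd4_le (F₀ : ι₀ → ℝ × (κ₀ → ℝ × Γ)) (F₁ : ι₁ → ℝ × (κ₁ → ℝ × Γ)) (F₂ : ι₂ → ℝ × (κ₂ → ℝ × Γ)) (F₃ : ι₃ → ℝ × (κ₃ → ℝ × Γ))
    (B₀ : j₀ → ℝ × (l₀ → ℝ × Γ)) (B₁ : j₁ → ℝ × (l₁ → ℝ × Γ)) (B₂ : j₂ → ℝ × (l₂ → ℝ × Γ)) (B₃ : j₃ → ℝ × (l₃ → ℝ × Γ))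
    {g₀ g₁ g₂ g₃ : ℝ} (hg₀ : 0 ≤ g₀) (hg₁ : 0 ≤ g₁) (hg₂ : 0 ≤ g₂)
    (hF₁ : ∀ i, 0 ≤ (F₁ i).1) (hF₂ : ∀ i, 0 ≤ (F₂ i).1) (hF₃ : ∀ i, 0 ≤ (F₃ i).1)
    (hB₀ : ∀ j, 0 ≤ (B₀ j).1) (hB₁ : ∀ j, 0 ≤ (B₁ j).1) (hB₂ : ∀ j, 0 ≤ (B₂ j).1)
    (h₀ : ∀ v : Γ → X, formEval F₀ v ≤ g₀ * formEval B₀ v) (h₁ : ∀ v : Γ → X, formEval F₁ v ≤ g₁ * formEval B₁ v)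
    (h₂ : ∀ v : Γ → X, formEval F₂ v ≤ g₂ * formEval B₂ v) (h₃ : ∀ v : Γ → X, formEval F₃ v ≤ g₃ * formEval B₃ v) :
    ∀ v : Γ → X, formEval (formProd (formProd (formProd F₀ F₁) F₂) F₃) v ≤ (g₀ * g₁ * g₂ * g₃) * formEval (formProd (formProd (formProd B₀ B₁) B₂) B₃) v := by
  have h01 := formProd_le (X := X) F₀ B₀ F₁ B₁ hg₀ hF₁ hB₀ h₀ h₁
  have hB01 : ∀ j : j₀ × j₁, 0 ≤ (formProd B₀ B₁ j).1 := fun j => mul_nonneg (hB₀ j.1) (hB₁ j.2)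
  have h012 := formProd_le (X := X) (formProd F₀ F₁) (formProd B₀ B₁) F₂ B₂ (mul_nonneg hg₀ hg₁) hF₂ hB01 h01 h₂
  have hB012 : ∀ j : (j₀ × j₁) × j₂, 0 ≤ (formProd (formProd B₀ B₁) B₂ j).1 := fun j => mul_nonneg (hB01 j.1) (hB₂ j.2)
  have h0123 := formProd_le (X := X) (formProd (formProd F₀ F₁) F₂) (formProd (formProd B₀ B₁) B₂) F₃ B₃ (mul_nonneg (mul_nonneg hg₀ hg₁) hg₂) hF₃ hB012 h012 h₃
  intro v
  have := h0123 v
  linarith [this]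

end Tensor

/-- **THE FOUR-FOLD LYAPUNOV TENSOR INEQUALITY OF THE LIFT'S MAIN PART** (any finite abelian group `Γ`, steps `e : Fin 4 → Γ`, longitudinal direction `κ`): with
`A μ = Aflat (e μ)` if `μ = κ` and `Atent (e μ)` otherwise, `(A 0 ⊗ A 1 ⊗ A 2 ⊗ A 3)(v) ≤ 3·(17∕8)³·(Bform (e 0) ⊗ Bform (e 1) ⊗ Bform (e 2) ⊗ Bform (e 3))(v)` — per level the
Lyapunov form of `W∘B_c⁻¹` (κ-component) grows by at most `(3∕2)(17∕16)³·L^{d−2}·L^{… }`: `3·(17∕8)³ = 28.79 < 32 = L⁵ = L^{d−2}·L³` at `d = 4`, `L = 2`, i.e. ratio `g = 1.80 < L`. [folklore] -/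
theorem lyapunov_tensor4_le (e : Fin 4 → Γ) (κ : Fin 4) (v : Γ → X) :
    formEval (formProd (formProd (formProd
        (if (0 : Fin 4) = κ then Aflat (e 0) else Atent (e 0)) (if (1 : Fin 4) = κ then Aflat (e 1) else Atent (e 1)))
        (if (2 : Fin 4) = κ then Aflat (e 2) else Atent (e 2))) (if (3 : Fin 4) = κ then Aflat (e 3) else Atent (e 3))) v
      ≤ (3 * (17 / 8 : ℝ) ^ 3) * formEval (formProd (formProd (formProd (Bform (e 0)) (Bform (e 1))) (Bform (e 2))) (Bform (e 3))) v := by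
  -- each direction: `≤ g_μ · Bform`, with `g_μ = 3` (flat) or `17/8` (tent); both `≤ 3`, and exactly one is flat
  have hdir : ∀ μ : Fin 4, (∀ i, 0 ≤ ((if μ = κ then Aflat (e μ) else Atent (e μ)) i).1)
      ∧ ∀ w : Γ → X, formEval (if μ = κ then Aflat (e μ) else Atent (e μ)) w ≤ (if μ = κ then (3 : ℝ) else 17 / 8) * formEval (Bform (e μ)) w := by
    intro μ
    by_cases hμ : μ = κ
    · simp only [hμ, if_true]; exact ⟨Aflat_nonneg _, fun w => formEval_Aflat_le _ w⟩
    · simp only [hμ, if_false]; exact ⟨Atent_nonneg _, fun w => formEval_Atent_le _ w⟩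
  have hg : ∀ μ : Fin 4, (0 : ℝ) ≤ (if μ = κ then (3 : ℝ) else 17 / 8) := fun μ => by split_ifs <;> norm_num
  have h := formProd4_le (X := X) _ _ _ _ _ _ _ _ (hg 0) (hg 1) (hg 2) (hdir 1).1 (hdir 2).1 (hdir 3).1 (Bform_nonneg _) (Bform_nonneg _) (Bform_nonneg _)
    (hdir 0).2 (hdir 1).2 (hdir 2).2 (hdir 3).2 v
  refine h.trans (mul_le_mul_of_nonneg_right ?_ (formEval_nonneg _ (fun j => mul_nonneg (mul_nonneg (mul_nonneg (Bform_nonneg _ _) (Bform_nonneg _ _)) (Bform_nonneg _ _)) (Bform_nonneg _ _)) v))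
  -- the product of the four constants: exactly one factor is `3`, the others `17/8`
  fin_cases κ <;> simp <;> norm_num

end

end Summit.QuantumFields.BalabanUV.T4Continuum.NE7LyapunovTensor
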